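import Summits.NavierStokesRegularity.FluidComputer.LambdaCeiling
import Literature.Analysis.FluidPDE.ConstantinSmallViscosityProofs
import Literature.Analysis.FluidPDE.NSStrongSpeedBound

/-!
# Fluid computer — LEVEL TRANSFER between sup-close fields: the saturation fronts of the viscous
# solution and of its Euler twin agree above a fixed level (rung R2, idea-2 cards O9/O10; pub-fluidc-lit gen 37)

HONEST FRAMING (cell `pub-fluidc`, verbatim): *low prior, high value-of-information experiment on Tao's
machine paradigm; NOT a claim that NS blows up.* Theorem side of the cell; nothing here is evidence of
blow-up.

Card O9 ("inviscid ceiling", `InviscidCeiling.lean`) and pre-registration P58/P59 of the negation seat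
read the amplitude rung through the Cheskidov–Shvydkoy saturation predicate
`IsSaturatedLevel c₀ ν v j : ofReal (c₀ν)·2^j ≤ ‖Δ̇_j v‖_∞` (tree:
`Literature.Analysis.FluidPDE.IsSaturatedLevel`, arXiv:1102.1944 §3) applied to BOTH the viscous slice
`u^ν(t)` and its Euler twin `U(t)` at the same `ν`: *"inside the Euler twin's trusted window the NS floor
front IS the Euler spectrum's floor crossing"* (P59 HIT, median `k_sat^obs/k_sat^pred = 1.000`). This
file is the typed dictionary behind that reading, with the inviscid closeness as an explicit SUP-NORM
hypothesis `‖u^ν(t) − U(t)‖_∞ ≤ δ`: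

* §1 `exists_blockSup_le_add`: ONE constant `C` (the `L^∞ → L^∞` norm of the tree's Littlewood–Paley
  block, `Literature.Analysis.FunctionSpaces.exists_eLpNorm_top_blockFn_le_eLpNorm ⊤`, i.e. Young with
  `‖Ǩ‖_{L¹}`) such that `‖Δ̇_j w‖_∞ ≤ ‖Δ̇_j v‖_∞ + C‖w − v‖_∞` for all levels `j` and all `L²` fields
  `v, w` with `w − v ∈ L^∞`;
* §2 `IsSaturatedLevel.transfer`: if level `j` of `w` is saturated at threshold `c₀ + s` and
  `‖w − v‖_∞ ≤ δ` with `C δ ≤ s ν 2^j`, then level `j` of `v` is saturated at threshold `c₀` — the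
  threshold shift a sup-error `δ` costs at level `j` is `Cδ/(ν 2^j)`, DECREASING in the level;
  `dissipationWavenumber_transfer`: `Λ_{c₀+s,ν}(w) ≤ 2^{j₀} ⊔ Λ_{c₀,ν}(v)` once `Cδ ≤ sν2^{j₀}`;
* §3 the twins: for two time-dependent fields on `[0,T]` with `‖u(t) − U(t)‖_∞ ≤ Kν` (sup-norm inviscid
  closeness AT RATE `ν` — for smooth Euler data on a fixed window this is Constantin 1986 Thm 1.1, tree
  `Literature.Analysis.FluidPDE.constantin_small_viscosity_holds` (`H^m` closeness `≤ Cν`, `m ≥ 3`),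
  combined with Agmon's inequality, tree `Literature.Analysis.FluidPDE.norm_apply_le_agmon`; the
  combination is NOT re-derived here and enters as the hypothesis `hclose`), every threshold margin
  `s > 0` has a level `j₀`, INDEPENDENT OF `ν`, above which saturation transfers both ways between `u(t)`
  and `U(t)` with thresholds `c₀ + s ↦ c₀` (`twin_transfer_above`), and the fronts compare as
  `Λ_{c₀+s,ν}(U t) ≤ 2^{j₀} ⊔ Λ_{c₀,ν}(u t)`, `Λ_{c₀+s,ν}(u t) ≤ 2^{j₀} ⊔ Λ_{c₀,ν}(U t)` (`twin_fronts`).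
  Reading (hedged): within a Constantin window the Reynolds number moves neither front relative to the
  other above level `j₀(s) = ⌈log₂(CK/s)⌉`; what Re decides is only where the common threshold `c₀ν2^j`
  cuts the (Euler) block amplitudes — idea-2's "Re only decides where Euler's spectrum is cut";
* §4 the hypothesis discharged from the tree: `norm_le_of_sobolev_le` (Agmon: `∫‖Dⁿv‖² ≤ ε²`, `n ≤ 2`
  ⇒ `sup|v| ≤ A·243^{1/4}·ε`), `constantin_sup_close` (Constantin 1986 Thm 1.1 as proved in the tree +
  Agmon ⇒ for a Beale–Kato–Majda-class Euler solution on `[0,T]` with rapidly decaying datum there are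
  `ν₀ > 0`, `K ≥ 0` such that for `0 < ν ≤ ν₀` the Navier–Stokes solution with the same datum satisfies
  `‖u(t,x) − U(t,x)‖ ≤ Kν` on `[0,T] × ℝ³`), and the headline `twin_fronts_of_constantin`: for every
  margin `s > 0` a `ν`-INDEPENDENT level `j₀` such that for all `0 < ν ≤ ν₀`, all `t ∈ [0,T]`, all
  `c₀ ≥ 0`, the fronts of `u^ν(t)` and `U(t)` obey `Λ_{c₀+s,ν}(U t) ≤ 2^{j₀} ⊔ Λ_{c₀,ν}(u t)`,
  `Λ_{c₀+s,ν}(u t) ≤ 2^{j₀} ⊔ Λ_{c₀,ν}(U t)` and saturation transfers both ways above `j₀`.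

## References

* A. Cheskidov, R. Shvydkoy, J. Math. Fluid Mech. 16 (2014) 263–273 = arXiv:1102.1944, §3.
  [CheskidovShvydkoy2011]
* P. Constantin, *Note on loss of regularity for solutions of the 3-D incompressible Euler and related
  equations*, Comm. Math. Phys. 104 (1986) 311–326, Thm. 1.1. [Constantin1986]
* H. Bahouri, J.-Y. Chemin, R. Danchin, *Fourier Analysis and Nonlinear PDE* (2011), Lemma 2.1.
  [BahouriCheminDanchin2011]
* J. C. Robinson, J. L. Rodrigo, W. Sadowski, *The Three-Dimensional Navier–Stokes Equations* (2016),
  Thm. 1.20 (Agmon's inequality). [RobinsonRodrigoSadowski2016]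
-/

noncomputable section

open MeasureTheory Set Function Filter Topology
open scoped ENNReal NNReal
open Literature.Analysis.FluidPDE Literature.Analysis.FunctionSpaces

namespace Summit.NavierStokesRegularity.FluidComputer.InviscidLevelTransfer


/-! ## §1 One constant: block sups of sup-close fields are close -/

/-- **Uniform `L^∞` bound of the blocks** (Young): one `C` with `‖Δ̇_j F‖_∞ ≤ C‖F‖_∞` for every level
`j` and every `F ∈ L^∞(ℝ³; ℝ³)` — the tree's `exists_eLpNorm_top_blockFn_le_eLpNorm` at `p = ∞`, where the
Bernstein factor `2^{3j/p}` is `1`. [cite: BahouriCheminDanchin2011, Lemma 2.1] -/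
theorem exists_blockSup_le : ∃ C : ℝ≥0, ∀ (j : ℤ) ⦃F : (EuclideanSpace ℝ (Fin 3)) → (EuclideanSpace ℝ (Fin 3))⦄,
    MemLp F ∞ volume →
    eLpNorm (blockFn j F) ∞ volume ≤ C * eLpNorm F ∞ volume := by
  obtain ⟨C, hC⟩ := exists_eLpNorm_top_blockFn_le_eLpNorm (E := (EuclideanSpace ℝ (Fin 3))) (ι := Fin 3) ∞
  refine ⟨C, fun j F hF => ?_⟩
  have h := hC j hF
  simpa only [ENNReal.toReal_top, inv_zero, mul_zero, ENNReal.rpow_zero, mul_one] using h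

/-- **Block sups of sup-close fields.** One constant `C` such that for all levels `j` and all `L²` fields
`v, w` on `ℝ³` with `w − v ∈ L^∞`: `‖Δ̇_j w‖_∞ ≤ ‖Δ̇_j v‖_∞ + C‖w − v‖_∞`. [cite: BahouriCheminDanchin2011, Lemma 2.1] -/
theorem exists_blockSup_le_add : ∃ C : ℝ≥0, ∀ (j : ℤ) ⦃v w : (EuclideanSpace ℝ (Fin 3)) → (EuclideanSpace ℝ (Fin 3))⦄,
    MemLp v 2 volume →
    MemLp w 2 volume → MemLp (w - v) ∞ volume →
    eLpNorm (blockFn j w) ∞ volume ≤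
      eLpNorm (blockFn j v) ∞ volume + C * eLpNorm (w - v) ∞ volume := by
  obtain ⟨C, hC⟩ := exists_blockSup_le
  refine ⟨C, fun j v w hv hw hd => ?_⟩
  have hsplit : blockFn j w = blockFn j v + blockFn j (w - v) := by
    rw [blockFn_sub j hw hv]; abel
  rw [hsplit]
  calc eLpNorm (blockFn j v + blockFn j (w - v)) ∞ volume
      ≤ eLpNorm (blockFn j v) ∞ volume + eLpNorm (blockFn j (w - v)) ∞ volume :=
        eLpNorm_add_le (aestronglyMeasurable_blockFn j hv.aestronglyMeasurable)
          (aestronglyMeasurable_blockFn j hd.aestronglyMeasurable) le_top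
    _ ≤ eLpNorm (blockFn j v) ∞ volume + C * eLpNorm (w - v) ∞ volume := by
        gcongr; exact hC j hd

/-! ## §2 Saturation transfers with a threshold shift `Cδ/(ν2^j)` -/

/-- **Level transfer.** Let `C` be a constant as in `exists_blockSup_le_add`. If level `j` of `w` is
saturated at threshold `c₀ + s` (`c₀, s, ν ≥ 0`), `‖w − v‖_∞ ≤ δ`, and the level is high enough that
`C δ ≤ s ν 2^j`, then level `j` of `v` is saturated at threshold `c₀`. [cite: CheskidovShvydkoy2011, §3 (definition of Λ)] -/
theorem IsSaturatedLevel.transfer {C : ℝ≥0}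
    (hC : ∀ (j : ℤ) ⦃v w : (EuclideanSpace ℝ (Fin 3)) → (EuclideanSpace ℝ (Fin 3))⦄, MemLp v 2 volume → MemLp w 2 volume → MemLp (w - v) ∞ volume →
      eLpNorm (blockFn j w) ∞ volume ≤ eLpNorm (blockFn j v) ∞ volume + C * eLpNorm (w - v) ∞ volume)
    {c₀ s ν δ : ℝ} (hc₀ : 0 ≤ c₀) (hs : 0 ≤ s) (hν : 0 ≤ ν) {v w : (EuclideanSpace ℝ (Fin 3)) → (EuclideanSpace ℝ (Fin 3))} (hv : MemLp v 2 volume)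
    (hw : MemLp w 2 volume) (hd : MemLp (w - v) ∞ volume)
    (hnear : eLpNorm (w - v) ∞ volume ≤ ENNReal.ofReal δ) {j : ℕ}
    (hlevel : (C : ℝ) * δ ≤ s * ν * 2 ^ j) (hsat : IsSaturatedLevel (c₀ + s) ν w j) :
    IsSaturatedLevel c₀ ν v j := by
  rw [isSaturatedLevel_iff] at hsat ⊢
  -- the shift `ofReal (sν) 2^j` is finite and dominates `C δ`
  have hshift : (C : ℝ≥0∞) * ENNReal.ofReal δ ≤ ENNReal.ofReal (s * ν) * 2 ^ j := by
    rw [LambdaCeiling.two_pow_eq_ofReal, ← ENNReal.ofReal_mul' (by positivity : (0 : ℝ) ≤ 2 ^ j),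
      ← ENNReal.ofReal_coe_nnreal]
    by_cases hδ : 0 ≤ δ
    · rw [← ENNReal.ofReal_mul (NNReal.coe_nonneg C)]
      exact ENNReal.ofReal_le_ofReal hlevel
    · rw [ENNReal.ofReal_of_nonpos (not_le.1 hδ).le, mul_zero]; exact bot_le
  have hsplit : ENNReal.ofReal ((c₀ + s) * ν) * 2 ^ j =
      ENNReal.ofReal (c₀ * ν) * 2 ^ j + ENNReal.ofReal (s * ν) * 2 ^ j := by
    rw [add_mul, ENNReal.ofReal_add (mul_nonneg hc₀ hν) (mul_nonneg hs hν), add_mul]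
  have hfin : ENNReal.ofReal (s * ν) * 2 ^ j ≠ ∞ :=
    ENNReal.mul_ne_top ENNReal.ofReal_ne_top (ENNReal.pow_ne_top (by norm_num))
  have key : ENNReal.ofReal (c₀ * ν) * 2 ^ j + ENNReal.ofReal (s * ν) * 2 ^ j ≤
      eLpNorm (blockFn (j : ℤ) v) ∞ volume + ENNReal.ofReal (s * ν) * 2 ^ j :=
    calc ENNReal.ofReal (c₀ * ν) * 2 ^ j + ENNReal.ofReal (s * ν) * 2 ^ j
        = ENNReal.ofReal ((c₀ + s) * ν) * 2 ^ j := hsplit.symm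
      _ ≤ eLpNorm (blockFn (j : ℤ) w) ∞ volume := hsat
      _ ≤ eLpNorm (blockFn (j : ℤ) v) ∞ volume + C * eLpNorm (w - v) ∞ volume := hC j hv hw hd
      _ ≤ eLpNorm (blockFn (j : ℤ) v) ∞ volume + C * ENNReal.ofReal δ := by gcongr
      _ ≤ eLpNorm (blockFn (j : ℤ) v) ∞ volume + ENNReal.ofReal (s * ν) * 2 ^ j := by gcongr
  exact (ENNReal.add_le_add_iff_right hfin).1 key

/-- **The higher the level, the cheaper the transfer**: the level condition `Cδ ≤ sν2^j` is monotone in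
`j`. [folklore] -/
theorem level_condition_mono {C δ s ν : ℝ} (hs : 0 ≤ s) (hν : 0 ≤ ν) {j₀ j : ℕ} (hj : j₀ ≤ j)
    (h0 : C * δ ≤ s * ν * 2 ^ j₀) : C * δ ≤ s * ν * 2 ^ j :=
  h0.trans (mul_le_mul_of_nonneg_left (pow_le_pow_right₀ one_le_two hj) (mul_nonneg hs hν))

/-- **Front transfer.** With `C` as in `exists_blockSup_le_add`, `‖w − v‖_∞ ≤ δ` and a level `j₀` with
`Cδ ≤ sν2^{j₀}`: `Λ_{c₀+s,ν}(w) ≤ 2^{j₀} ⊔ Λ_{c₀,ν}(v)` — every `(c₀+s)`-saturated level of `w` above `j₀`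
is a `c₀`-saturated level of `v`. [cite: CheskidovShvydkoy2011, §3 (definition of Λ)] -/
theorem dissipationWavenumber_transfer {C : ℝ≥0}
    (hC : ∀ (j : ℤ) ⦃v w : (EuclideanSpace ℝ (Fin 3)) → (EuclideanSpace ℝ (Fin 3))⦄, MemLp v 2 volume → MemLp w 2 volume → MemLp (w - v) ∞ volume →
      eLpNorm (blockFn j w) ∞ volume ≤ eLpNorm (blockFn j v) ∞ volume + C * eLpNorm (w - v) ∞ volume)
    {c₀ s ν δ : ℝ} (hc₀ : 0 ≤ c₀) (hs : 0 ≤ s) (hν : 0 ≤ ν) {v w : (EuclideanSpace ℝ (Fin 3)) → (EuclideanSpace ℝ (Fin 3))} (hv : MemLp v 2 volume)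
    (hw : MemLp w 2 volume) (hd : MemLp (w - v) ∞ volume)
    (hnear : eLpNorm (w - v) ∞ volume ≤ ENNReal.ofReal δ) {j₀ : ℕ}
    (hlevel : (C : ℝ) * δ ≤ s * ν * 2 ^ j₀) :
    dissipationWavenumber (c₀ + s) ν w ≤ (2 : ℝ≥0∞) ^ j₀ ⊔ dissipationWavenumber c₀ ν v := by
  refine dissipationWavenumber_le (le_sup_of_le_right (one_le_dissipationWavenumber _ _ _))
    fun j hj => ?_
  rcases lt_or_ge j j₀ with hlt | hge
  · exact le_sup_of_le_left (pow_le_pow_right₀ one_le_two hlt.le)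
  · exact le_sup_of_le_right (two_pow_le_dissipationWavenumber
      (IsSaturatedLevel.transfer hC hc₀ hs hν hv hw hd hnear (level_condition_mono hs hν hge hlevel) hj))

/-! ## §3 The viscous solution and its Euler twin under sup-norm closeness at rate `ν` -/

/-- **A ν-independent transfer level.** For `C ≥ 0`, `K`, and a margin `s > 0` there is a level `j₀` with
`C (K ν) ≤ s ν 2^{j₀}` for EVERY `ν ≥ 0`: the rate-`ν` closeness exactly cancels the `ν` in the
threshold. [folklore] -/
theorem exists_level_uniform (C K s : ℝ) (hs : 0 < s) :
    ∃ j₀ : ℕ, ∀ ν : ℝ, 0 ≤ ν → C * (K * ν) ≤ s * ν * 2 ^ j₀ := by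
  obtain ⟨j₀, hj₀⟩ := pow_unbounded_of_one_lt (C * K / s) one_lt_two
  refine ⟨j₀, fun ν hν => ?_⟩
  have h1 : C * K ≤ s * 2 ^ j₀ := by
    rw [div_lt_iff₀ hs] at hj₀; linarith [mul_comm (2 ^ j₀ : ℝ) s]
  calc C * (K * ν) = (C * K) * ν := by ring
    _ ≤ (s * 2 ^ j₀) * ν := mul_le_mul_of_nonneg_right h1 hν
    _ = s * ν * 2 ^ j₀ := by ring

/-- **Twin transfer above a fixed level.** Two families of `L²` slices `u(t)`, `U(t)` on `[0,T]` (think: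
the viscous solution and its Euler twin) with bounded differences and SUP-NORM CLOSENESS AT RATE `ν`,
`‖u(t) − U(t)‖_∞ ≤ Kν` on `[0,T]`. Then for every margin `s > 0` there is a level `j₀`, independent of
`ν`, such that at every `t ∈ [0,T]` and every level `j ≥ j₀` saturation transfers both ways with
thresholds `c₀ + s ↦ c₀` (`c₀ ≥ 0`). [cite: CheskidovShvydkoy2011, §3 (definition of Λ)] -/
theorem twin_transfer_above :
    ∀ (K s : ℝ), 0 < s → ∃ j₀ : ℕ, ∀ (ν T : ℝ), 0 ≤ ν →
      ∀ (u U : ℝ → (EuclideanSpace ℝ (Fin 3)) → (EuclideanSpace ℝ (Fin 3))),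
      (∀ t ∈ Icc 0 T, MemLp (u t) 2 volume) → (∀ t ∈ Icc 0 T, MemLp (U t) 2 volume) →
      (∀ t ∈ Icc 0 T, MemLp (u t - U t) ∞ volume) →
      (∀ t ∈ Icc 0 T, eLpNorm (u t - U t) ∞ volume ≤ ENNReal.ofReal (K * ν)) →
      ∀ c₀ : ℝ, 0 ≤ c₀ → ∀ t ∈ Icc 0 T, ∀ j : ℕ, j₀ ≤ j →
        (IsSaturatedLevel (c₀ + s) ν (U t) j → IsSaturatedLevel c₀ ν (u t) j) ∧
        (IsSaturatedLevel (c₀ + s) ν (u t) j → IsSaturatedLevel c₀ ν (U t) j) := by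
  intro K s hs
  obtain ⟨C, hC⟩ := exists_blockSup_le_add
  obtain ⟨j₀, hj₀⟩ := exists_level_uniform C K s hs
  refine ⟨j₀, fun ν T hν u U hu hU hd hclose c₀ hc₀ t ht j hj => ?_⟩
  have hlev : (C : ℝ) * (K * ν) ≤ s * ν * 2 ^ j := level_condition_mono hs.le hν hj (hj₀ ν hν)
  -- the difference the other way round
  have hd' : MemLp (U t - u t) ∞ volume := by rw [← neg_sub]; exact (hd t ht).neg
  have hclose' : eLpNorm (U t - u t) ∞ volume ≤ ENNReal.ofReal (K * ν) := by
    rw [← neg_sub, eLpNorm_neg]; exact hclose t ht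
  exact ⟨fun hsat => IsSaturatedLevel.transfer hC hc₀ hs.le hν (hu t ht) (hU t ht) hd' hclose' hlev hsat,
    fun hsat =>
      IsSaturatedLevel.transfer hC hc₀ hs.le hν (hU t ht) (hu t ht) (hd t ht) (hclose t ht) hlev hsat⟩

/-- **Twin fronts.** Same setting: for every margin `s > 0` a ν-independent level `j₀` with, at every
`t ∈ [0,T]`, `Λ_{c₀+s,ν}(U t) ≤ 2^{j₀} ⊔ Λ_{c₀,ν}(u t)` and `Λ_{c₀+s,ν}(u t) ≤ 2^{j₀} ⊔ Λ_{c₀,ν}(U t)`: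
above `j₀` the two saturation fronts agree up to the threshold margin `s`, whatever `ν`. [cite: CheskidovShvydkoy2011, §3 (definition of Λ)] -/
theorem twin_fronts :
    ∀ (K s : ℝ), 0 < s → ∃ j₀ : ℕ, ∀ (ν T : ℝ), 0 ≤ ν →
      ∀ (u U : ℝ → (EuclideanSpace ℝ (Fin 3)) → (EuclideanSpace ℝ (Fin 3))),
      (∀ t ∈ Icc 0 T, MemLp (u t) 2 volume) → (∀ t ∈ Icc 0 T, MemLp (U t) 2 volume) →
      (∀ t ∈ Icc 0 T, MemLp (u t - U t) ∞ volume) →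
      (∀ t ∈ Icc 0 T, eLpNorm (u t - U t) ∞ volume ≤ ENNReal.ofReal (K * ν)) →
      ∀ c₀ : ℝ, 0 ≤ c₀ → ∀ t ∈ Icc 0 T,
        dissipationWavenumber (c₀ + s) ν (U t) ≤ (2 : ℝ≥0∞) ^ j₀ ⊔ dissipationWavenumber c₀ ν (u t) ∧
        dissipationWavenumber (c₀ + s) ν (u t) ≤ (2 : ℝ≥0∞) ^ j₀ ⊔ dissipationWavenumber c₀ ν (U t) := by
  intro K s hs
  obtain ⟨C, hC⟩ := exists_blockSup_le_add
  obtain ⟨j₀, hj₀⟩ := exists_level_uniform C K s hs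
  refine ⟨j₀, fun ν T hν u U hu hU hd hclose c₀ hc₀ t ht => ?_⟩
  have hd' : MemLp (U t - u t) ∞ volume := by rw [← neg_sub]; exact (hd t ht).neg
  have hclose' : eLpNorm (U t - u t) ∞ volume ≤ ENNReal.ofReal (K * ν) := by
    rw [← neg_sub, eLpNorm_neg]; exact hclose t ht
  exact ⟨dissipationWavenumber_transfer hC hc₀ hs.le hν (hu t ht) (hU t ht) hd' hclose' (hj₀ ν hν),
    dissipationWavenumber_transfer hC hc₀ hs.le hν (hU t ht) (hu t ht) (hd t ht) (hclose t ht) (hj₀ ν hν)⟩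

/-! ## §4 The hypothesis `‖u(t) − U(t)‖_∞ ≤ Kν` from Constantin 1986 (tree) + Agmon (tree) -/

/-- **Sobolev-to-sup (Agmon).** A smooth field `v : ℝ³ → ℝ³` with `∫‖Dⁿv‖² ≤ ε²` for `n = 0, 1, 2`
(`ε ≥ 0`) obeys `‖v(x)‖ ≤ A·243^{1/4}·ε` for all `x`, `A` the tree's Agmon constant
(`Literature.Analysis.FluidPDE.norm_apply_le_agmon`: `sup|v| ≤ A (∫|∇v|²)^{1/4}(∫|∇²v|²)^{1/4}`, with
`∫|∇ⁿv|² ≤ 3^{n+1}∫‖Dⁿv‖²`). [cite: RobinsonRodrigoSadowski2016, Thm. 1.20] -/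
theorem norm_le_of_sobolev_le {v : (EuclideanSpace ℝ (Fin 3)) → (EuclideanSpace ℝ (Fin 3))}
    (hv : ContDiff ℝ ((⊤ : ℕ∞) : WithTop ℕ∞) v) {ε : ℝ} (hε : 0 ≤ ε)
    (h : ∀ n ≤ 2, ∫⁻ x, ‖iteratedFDeriv ℝ n v x‖ₑ ^ 2 ≤ ENNReal.ofReal ε ^ 2) (x : (EuclideanSpace ℝ (Fin 3))) :
    ‖v x‖ ≤ agmonConst * (243 : ℝ) ^ (1 / 4 : ℝ) * ε := by
  have hI : ∀ n ≤ 2, Integrable (levelSq n v) ∧ ∫ y, levelSq n v y ≤ 3 ^ (n + 1) * ε ^ 2 := by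
    intro n hn
    have hfin : ∫⁻ x, ‖iteratedFDeriv ℝ n v x‖ₑ ^ 2 < ⊤ :=
      (h n hn).trans_lt (lt_top_iff_ne_top.2 (ENNReal.pow_ne_top ENNReal.ofReal_ne_top))
    obtain ⟨hint, hle⟩ := integrable_levelSq_of_lintegral_lt_top hv n hfin
    refine ⟨hint, hle.trans (mul_le_mul_of_nonneg_left ?_ (by positivity))⟩
    calc (∫⁻ x, ‖iteratedFDeriv ℝ n v x‖ₑ ^ 2).toReal ≤ (ENNReal.ofReal ε ^ 2).toReal :=
          ENNReal.toReal_mono (ENNReal.pow_ne_top ENNReal.ofReal_ne_top) (h n hn)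
      _ = ε ^ 2 := by rw [ENNReal.toReal_pow, ENNReal.toReal_ofReal hε]
  have hA := norm_apply_le_agmon hv (hI 0 (by norm_num)).1 (hI 1 (by norm_num)).1
    (hI 2 (by norm_num)).1 x
  have h10 : 0 ≤ ∫ y, levelSq 1 v y := integral_nonneg fun y => levelSq_nonneg 1 v y
  have h20 : 0 ≤ ∫ y, levelSq 2 v y := integral_nonneg fun y => levelSq_nonneg 2 v y
  have h1 : ∫ y, levelSq 1 v y ≤ 9 * ε ^ 2 := by
    have := (hI 1 (by norm_num)).2; norm_num at this; linarith
  have h2 : ∫ y, levelSq 2 v y ≤ 27 * ε ^ 2 := by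
    have := (hI 2 (by norm_num)).2; norm_num at this; linarith
  have hprod : (∫ y, levelSq 1 v y) * ∫ y, levelSq 2 v y ≤ 243 * ε ^ 4 :=
    calc (∫ y, levelSq 1 v y) * ∫ y, levelSq 2 v y ≤ (9 * ε ^ 2) * (27 * ε ^ 2) :=
          mul_le_mul h1 h2 h20 (by positivity)
      _ = 243 * ε ^ 4 := by ring
  have hroot : (243 * ε ^ 4 : ℝ) ^ (1 / 4 : ℝ) = (243 : ℝ) ^ (1 / 4 : ℝ) * ε := by
    rw [Real.mul_rpow (by norm_num) (by positivity), ← Real.rpow_natCast ε 4, ← Real.rpow_mul hε]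
    norm_num
  calc ‖v x‖ ≤ agmonConst * ((∫ y, levelSq 1 v y) * ∫ y, levelSq 2 v y) ^ (1 / 4 : ℝ) := hA
    _ ≤ agmonConst * (243 * ε ^ 4 : ℝ) ^ (1 / 4 : ℝ) :=
        mul_le_mul_of_nonneg_left (Real.rpow_le_rpow (mul_nonneg h10 h20) hprod (by norm_num))
          agmonConst_nonneg
    _ = agmonConst * (243 : ℝ) ^ (1 / 4 : ℝ) * ε := by rw [hroot, mul_assoc]

/-- **Constantin 1986 + Agmon: sup-norm inviscid closeness at rate `ν`.** For a classical Euler solution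
`(U, P)` on `[0,T] × ℝ³` in the Beale–Kato–Majda class with rapidly decaying datum there are `ν₀ > 0`
and `K ≥ 0` such that for every `0 < ν ≤ ν₀` the classical Navier–Stokes solution `u` with the same datum
provided by Constantin's theorem (tree: `constantin_small_viscosity_holds`, `H³`-closeness `≤ Cν`) satisfies
`‖u(t,x) − U(t,x)‖ ≤ Kν` for all `t ∈ [0,T]`, `x ∈ ℝ³`. [cite: Constantin1986, Thm. 1.1] -/
theorem constantin_sup_close {T : ℝ} (hT : 0 < T) {U : ℝ → (EuclideanSpace ℝ (Fin 3)) → (EuclideanSpace ℝ (Fin 3))}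
    {P : ℝ → (EuclideanSpace ℝ (Fin 3)) → ℝ}
    (hE : IsClassicalEulerSolutionOn (Icc 0 T) 0 U P) (hB : HasBoundedSobolevNormsOn (Icc 0 T) U)
    (hdec : HasRapidSpatialDecay (U 0)) :
    ∃ ν₀ : ℝ, 0 < ν₀ ∧ ∃ K : ℝ, 0 ≤ K ∧ ∀ ν : ℝ, 0 < ν → ν ≤ ν₀ →
      ∃ (u : ℝ → (EuclideanSpace ℝ (Fin 3)) → (EuclideanSpace ℝ (Fin 3))) (p : ℝ → (EuclideanSpace ℝ (Fin 3)) → ℝ),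
        IsClassicalNSSolutionOn (Icc 0 T) ν 0 u p ∧ HasBoundedSobolevNormsOn (Icc 0 T) u ∧ u 0 = U 0 ∧
        ∀ t ∈ Icc 0 T, ∀ x, ‖u t x - U t x‖ ≤ K * ν := by
  obtain ⟨ν₀, hν₀, C, hC⟩ := constantin_small_viscosity_holds 3 le_rfl T hT U P hE hB hdec
  refine ⟨ν₀, hν₀, agmonConst * (243 : ℝ) ^ (1 / 4 : ℝ) * max C 0,
    mul_nonneg (mul_nonneg agmonConst_nonneg (Real.rpow_nonneg (by norm_num) _)) (le_max_right _ _),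
    fun ν hν hνν₀ => ?_⟩
  obtain ⟨u, p, hu, hbu, h0, hH⟩ := hC ν hν hνν₀
  refine ⟨u, p, hu, hbu, h0, fun t ht x => ?_⟩
  have hv : ContDiff ℝ ((⊤ : ℕ∞) : WithTop ℕ∞) (u t - U t) :=
    (hu.contDiff_velocity ht).sub (IsClassicalNSSolutionOn.contDiff_velocity hE ht)
  have hε : 0 ≤ max C 0 * ν := mul_nonneg (le_max_right _ _) hν.le
  have hle : ∀ n ≤ 2, ∫⁻ y, ‖iteratedFDeriv ℝ n (u t - U t) y‖ₑ ^ 2 ≤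
      ENNReal.ofReal (max C 0 * ν) ^ 2 := fun n hn =>
    (hH t ht n (hn.trans (by norm_num))).trans (pow_le_pow_left' (ENNReal.ofReal_le_ofReal
      (mul_le_mul_of_nonneg_right (le_max_left _ _) hν.le)) 2)
  calc ‖u t x - U t x‖ = ‖(u t - U t) x‖ := rfl
    _ ≤ agmonConst * (243 : ℝ) ^ (1 / 4 : ℝ) * (max C 0 * ν) := norm_le_of_sobolev_le hv hε hle x
    _ = agmonConst * (243 : ℝ) ^ (1 / 4 : ℝ) * max C 0 * ν := by ring

/-- Slices in the Beale–Kato–Majda class are `L²`. [folklore] -/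
theorem memLp_two_of_sobolev {S : Set ℝ} {u : ℝ → (EuclideanSpace ℝ (Fin 3)) → (EuclideanSpace ℝ (Fin 3))}
    (hsm : ∀ t ∈ S, ContDiff ℝ ((⊤ : ℕ∞) : WithTop ℕ∞) (u t))
    (hB : HasBoundedSobolevNormsOn S u) {t : ℝ} (ht : t ∈ S) : MemLp (u t) 2 volume := by
  obtain ⟨C0, hC0⟩ := hB 0
  have hfin : ∫⁻ x, ‖iteratedFDeriv ℝ 0 (u t) x‖ₑ ^ 2 < ⊤ := (hC0 t ht).trans_lt ENNReal.coe_lt_top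
  have hint : Integrable (fun x => ‖iteratedFDeriv ℝ 0 (u t) x‖ ^ 2) volume :=
    integrable_sq_norm_of_lintegral_lt_top
      ((hsm t ht).continuous_iteratedFDeriv (by exact_mod_cast le_top)) hfin
  have hint' : Integrable (fun x => ‖u t x‖ ^ 2) volume :=
    hint.congr (Eventually.of_forall fun x => by simp [norm_iteratedFDeriv_zero])
  exact (memLp_two_iff_integrable_sq_norm (hsm t ht).continuous.aestronglyMeasurable).2 hint'

/-- **Twin fronts, Constantin-fed.** For a classical Euler solution `(U, P)` on `[0,T] × ℝ³` in the
Beale–Kato–Majda class with rapidly decaying datum, and every threshold margin `s > 0`: there are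
`ν₀ > 0` and a level `j₀` — INDEPENDENT OF `ν` — such that for every `0 < ν ≤ ν₀` the Navier–Stokes
solution `u` with the same datum (Constantin) and its Euler twin `U` satisfy, at every `t ∈ [0,T]` and
every `c₀ ≥ 0`, `Λ_{c₀+s,ν}(U t) ≤ 2^{j₀} ⊔ Λ_{c₀,ν}(u t)` and `Λ_{c₀+s,ν}(u t) ≤ 2^{j₀} ⊔ Λ_{c₀,ν}(U t)`,
and above `j₀` saturation transfers both ways with thresholds `c₀ + s ↦ c₀`. [cite: Constantin1986, Thm. 1.1] -/
theorem twin_fronts_of_constantin {T : ℝ} (hT : 0 < T) {U : ℝ → (EuclideanSpace ℝ (Fin 3)) → (EuclideanSpace ℝ (Fin 3))}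
    {P : ℝ → (EuclideanSpace ℝ (Fin 3)) → ℝ}
    (hE : IsClassicalEulerSolutionOn (Icc 0 T) 0 U P) (hB : HasBoundedSobolevNormsOn (Icc 0 T) U)
    (hdec : HasRapidSpatialDecay (U 0)) {s : ℝ} (hs : 0 < s) :
    ∃ ν₀ : ℝ, 0 < ν₀ ∧ ∃ j₀ : ℕ, ∀ ν : ℝ, 0 < ν → ν ≤ ν₀ →
      ∃ (u : ℝ → (EuclideanSpace ℝ (Fin 3)) → (EuclideanSpace ℝ (Fin 3))) (p : ℝ → (EuclideanSpace ℝ (Fin 3)) → ℝ),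
        IsClassicalNSSolutionOn (Icc 0 T) ν 0 u p ∧ u 0 = U 0 ∧
        ∀ c₀ : ℝ, 0 ≤ c₀ → ∀ t ∈ Icc 0 T,
          (dissipationWavenumber (c₀ + s) ν (U t) ≤ (2 : ℝ≥0∞) ^ j₀ ⊔ dissipationWavenumber c₀ ν (u t) ∧
           dissipationWavenumber (c₀ + s) ν (u t) ≤ (2 : ℝ≥0∞) ^ j₀ ⊔ dissipationWavenumber c₀ ν (U t)) ∧
          ∀ j : ℕ, j₀ ≤ j →
            (IsSaturatedLevel (c₀ + s) ν (U t) j → IsSaturatedLevel c₀ ν (u t) j) ∧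
            (IsSaturatedLevel (c₀ + s) ν (u t) j → IsSaturatedLevel c₀ ν (U t) j) := by
  obtain ⟨ν₀, hν₀, K, -, hK⟩ := constantin_sup_close hT hE hB hdec
  obtain ⟨j₀, hj₀⟩ := twin_fronts K s hs
  obtain ⟨j₀', hj₀'⟩ := twin_transfer_above K s hs
  refine ⟨ν₀, hν₀, max j₀ j₀', fun ν hν hνν₀ => ?_⟩
  obtain ⟨u, p, hu, hbu, h0, hclose⟩ := hK ν hν hνν₀
  refine ⟨u, p, hu, h0, fun c₀ hc₀ t ht => ?_⟩
  -- the hypotheses of §3 for the pair (u, U)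
  have hu2 : ∀ t ∈ Icc 0 T, MemLp (u t) 2 volume := fun t ht =>
    memLp_two_of_sobolev (fun t ht => hu.contDiff_velocity ht) hbu ht
  have hU2 : ∀ t ∈ Icc 0 T, MemLp (U t) 2 volume := fun t ht =>
    memLp_two_of_sobolev (fun t ht => IsClassicalNSSolutionOn.contDiff_velocity hE ht) hB ht
  have hmeas : ∀ t ∈ Icc 0 T, AEStronglyMeasurable (u t - U t) volume := fun t ht =>
    ((hu.contDiff_velocity ht).sub (IsClassicalNSSolutionOn.contDiff_velocity hE ht)).continuous
      |>.aestronglyMeasurable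
  have hd : ∀ t ∈ Icc 0 T, MemLp (u t - U t) ∞ volume := fun t ht =>
    memLp_top_of_bound (hmeas t ht) (K * ν) (Eventually.of_forall (hclose t ht))
  have hcl : ∀ t ∈ Icc 0 T, eLpNorm (u t - U t) ∞ volume ≤ ENNReal.ofReal (K * ν) := fun t ht => by
    rw [eLpNorm_exponent_top]
    exact eLpNormEssSup_le_of_ae_bound (Eventually.of_forall (hclose t ht))
  have hF := hj₀ ν T hν.le u U hu2 hU2 hd hcl c₀ hc₀ t ht
  have hG := hj₀' ν T hν.le u U hu2 hU2 hd hcl c₀ hc₀ t ht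
  have hpow : (2 : ℝ≥0∞) ^ j₀ ≤ 2 ^ max j₀ j₀' := pow_le_pow_right₀ one_le_two (le_max_left _ _)
  refine ⟨⟨hF.1.trans (sup_le_sup_right hpow _), hF.2.trans (sup_le_sup_right hpow _)⟩,
    fun j hj => hG j ((le_max_right _ _).trans hj)⟩

end Summit.NavierStokesRegularity.FluidComputer.InviscidLevelTransfer

end
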